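import Summits.QuantumFields.BalabanUV.Beta.GAN24.FibreKernelControl

/-!
# `BalabanUV.Beta.GAN24.FibreKernelControlBounds` — binder row G-an2-4 / (CONV-C), road P1-fibre, self-row **N15k-ker*** PART 2:
# the four KERNEL-CONTROL INEQUALITIES of a real KKT fibre in FINE units and the assembled bound `Σ‖A‖² ≤ K·E(A)`

NOT IN PRINT; OUR PROOF ATTEMPT.  HONEST FRAMING (cell contract, verbatim): «discharging `BetaPertH` makes Bałaban's UV stability
UNCONDITIONAL — a real constructive-QFT result; it is NOT the continuum limit and NOT the Clay problem.»  HONEST DEPENDENCY (verbatim):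
«continuum YM on T⁴ ⇐ BetaPertH ∧ nine spine estimates (0/9 proved); BetaPertH ⇐ (D1) ∧ (D4) ∧ CAP+tail; G-an2-4 gates asym, D1 and
NE2/3/4.»  [folklore] finite-dimensional norm bookkeeping over `ℂ` on top of PART 1 (`GAN24/FibreKernelControl`); no cited fact, no wall
binder, no `def`, no unit sequence touched (ref2 c2/c3).  NOT summit progress; discharges nothing of the K-slot `GAN24.CombesThomas.ConvCK 3 Lc`.

## What is proved (abstract `F : Fibre D ι` on the real zone `∂♭ = conj ∂`; `(A, c) ∈ ker B`, i.e. `GRows F 0 A c ∧ QRows F 0 A`; `E = energy F A`)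
* (o1) `norm_c_mul_norm_capV_le`: `‖c‖·‖capV F κ‖ ≤ √((Σ_m‖wQ_{mκ}‖²/ℓ_m)·E)` for every `κ`; named-constant form `norm_c_le`
  (`aF ≥ Σ_m‖wQ_{mκ}‖²/ℓ_m`, `0 < v ≤ ‖capV F κ‖` ⟹ `‖c‖ ≤ √(aF·E)/v`); summed form `norm_c_sq_mul_sum_le` (`‖c‖²Σ_κ‖capV_κ‖² ≤ (Σ_κ aFull_κ)·E`);
* (o2) `norm_wQ_mul_norm_apply_le`: `‖wQ_{m₀κ}‖·‖A_{m₀κ}‖ ≤ √((Σ_{m≠m₀}‖wQ_{mκ}‖²/ℓ_m)·E) + ‖c‖·‖Σ_{m≠m₀} wQ_{mκ}∂_{mκ}wG_m/L_m²‖`;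
* (o3) `sum_normSq_trans_le`: `0 < λ ≤ ℓ_m (m ≠ m₀)` ⟹ `Σ_{m≠m₀}Σ_κ‖t_{mκ}‖² ≤ E/λ`;
* (o4) `sum_normSq_eq_of_GRows'`: `Σ_{m∈s}Σ_κ‖A_{mκ}‖² = Σ_{m∈s}Σ_κ‖t_{mκ}‖² + ‖c‖²·Σ_{m∈s}‖wG_m‖²/ℓ_m³`;
* **`sum_normSq_le_energy`**: with `β ≤ ‖wQ_{m₀κ}‖`, `aO`, `bO`, `gO` the displayed off-`m₀` alias sums and `‖c‖ ≤ Cc√E`,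
  `Σ_m Σ_κ ‖A_{mκ}‖² ≤ (D·((√aO + Cc·bO)/β)² + 1/λ + Cc²·gO)·E`, plus `norm_c_sq_le` (`‖c‖² ≤ Cc²E`) for the gauge constant's own weight.
FIBRE READING (for the instantiation module / the L10 owner; nothing of it is asserted here): at `fibreAl N (ofRealVec q)`, `q ∈ BZ∖{0}`, `m₀ = 0`:
`Σ_m‖wQ_{mκ}‖²/ℓ_m = 2N^D·capDiag ≲ N^{2D+4}/|q|²`, `capV = σ·δ` with `σ ≳ N^{D+4}/|q|⁴` ⟹ `‖c‖ ≲ |q|²√E/N²`; `β = (2/π)^{D+1}N^{D+1}`, `λ = 4/N²`,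
`aO ≲ N^{2D+4}·aliasWtConst`, `bO ≲ |q|·N^{D+4}·(alias sum)`, `gO ≲ N⁶·(alias sum)` ⟹ `Σ‖A‖² ≤ C(D)·N²·E`, `‖c‖² ≤ C(D)|q|⁴E/N⁴`: in the
weighting `(Â_0/N, √L_m Â_m (m ≠ 0), N²c)` both the kernel coercivity and `‖H‖` are `O(1)` uniformly in `N` and `q`.
Unit `b2b-balaban-gan24-formalise-leaf-10` (G-an2-4 formalisation swarm), 2026-08-20.
-/

noncomputable section

open Complex Finset
open scoped BigOperators ComplexConjugate

namespace Summit.QuantumFields.BalabanUV.Beta.GAN24.FibreKernelControlBounds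

open FibreBlockSolve (dot)
open CapacitanceSolve (Fibre GRows QRows capV)
open Summit.QuantumFields.BalabanUV.Beta.GAN24.FibreKernelControl

variable {D : ℕ} {ι : Type*}

/-! ## §5 The four kernel-control inequalities -/

/-- [folklore] **(o1) THE GAUGE CONSTANT IS PINNED BY THE BORDER**: on `ker B`, for every polarisation `κ`,
`‖c‖ · ‖capV_κ‖ ≤ √((Σ_m ‖wQ_{mκ}‖²/ℓ_m) · E(A))`.  (Fibre reading: `Σ_m‖wQ_{mκ}‖²/ℓ_m = 2N^D·a_κ ≍ N^{2D+4}/|q|²`, `capV = σ·δ` with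
`σ ≍ N^{D+4}/|q|⁴`, so `‖c‖ ≲ |q|²√E/N²` — the two powers of `|q|` GAINED here are what makes (o4) uniform.) -/
theorem norm_c_mul_norm_capV_le [Fintype ι] [DecidableEq ι] (F : Fibre D ι) (hre : ∀ m κ, F.db m κ = conj (F.dd m κ))
    {A : ι → Fin D → ℂ} {c : ℂ} (hG : GRows F 0 A c) (hQ : QRows F 0 A) (κ : Fin D) :
    ‖c‖ * ‖capV F κ‖ ≤ Real.sqrt ((∑ m, ‖F.wQ m κ‖ ^ 2 / blkLap (F.dd m)) * energy F A) := by
  have h := sum_wQ_trans_add_capV F hre hG hQ κ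
  rw [add_eq_zero_iff_neg_eq] at h
  rw [← norm_mul, ← h, norm_neg]
  exact norm_sum_wQ_trans_le F hre A Finset.univ κ

/-- [folklore] (o1) with named constants: `aF ≥ Σ_m ‖wQ_{mκ}‖²/ℓ_m`, `0 < v ≤ ‖capV_κ‖` ⟹ `‖c‖ ≤ √(aF·E(A))/v`. -/
theorem norm_c_le [Fintype ι] [DecidableEq ι] (F : Fibre D ι) (hre : ∀ m κ, F.db m κ = conj (F.dd m κ))
    {A : ι → Fin D → ℂ} {c : ℂ} (hG : GRows F 0 A c) (hQ : QRows F 0 A) (κ : Fin D) {aF v : ℝ}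
    (haF : ∑ m, ‖F.wQ m κ‖ ^ 2 / blkLap (F.dd m) ≤ aF) (hv : 0 < v) (hvle : v ≤ ‖capV F κ‖) :
    ‖c‖ ≤ Real.sqrt (aF * energy F A) / v := by
  rw [le_div_iff₀ hv]
  calc ‖c‖ * v ≤ ‖c‖ * ‖capV F κ‖ := mul_le_mul_of_nonneg_left hvle (norm_nonneg _)
    _ ≤ Real.sqrt ((∑ m, ‖F.wQ m κ‖ ^ 2 / blkLap (F.dd m)) * energy F A) := norm_c_mul_norm_capV_le F hre hG hQ κ
    _ ≤ Real.sqrt (aF * energy F A) := Real.sqrt_le_sqrt (mul_le_mul_of_nonneg_right haF (energy_nonneg F A))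

/-- [folklore] (o1) SUMMED OVER POLARISATIONS (no choice of `κ`): `‖c‖² · Σ_κ ‖capV_κ‖² ≤ (Σ_κ Σ_m ‖wQ_{mκ}‖²/ℓ_m) · E(A)`.
(Fibre reading: `Σ_κ‖capV_κ‖² = σ²·Σ_κ 4 sin²(q_κ/2) ≥ σ²·(4/π²)|q|²`.) -/
theorem norm_c_sq_mul_sum_le [Fintype ι] [DecidableEq ι] (F : Fibre D ι) (hre : ∀ m κ, F.db m κ = conj (F.dd m κ))
    {A : ι → Fin D → ℂ} {c : ℂ} (hG : GRows F 0 A c) (hQ : QRows F 0 A) :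
    ‖c‖ ^ 2 * ∑ κ, ‖capV F κ‖ ^ 2 ≤ (∑ κ, ∑ m, ‖F.wQ m κ‖ ^ 2 / blkLap (F.dd m)) * energy F A := by
  rw [Finset.mul_sum, Finset.sum_mul]
  refine Finset.sum_le_sum fun κ _ => ?_
  have h := norm_c_mul_norm_capV_le F hre hG hQ κ
  have h0 : 0 ≤ (∑ m, ‖F.wQ m κ‖ ^ 2 / blkLap (F.dd m)) * energy F A :=
    mul_nonneg (Finset.sum_nonneg fun m _ => div_nonneg (sq_nonneg _) (blkLap_nonneg _)) (energy_nonneg F A)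
  calc ‖c‖ ^ 2 * ‖capV F κ‖ ^ 2 = (‖c‖ * ‖capV F κ‖) ^ 2 := by ring
    _ ≤ Real.sqrt ((∑ m, ‖F.wQ m κ‖ ^ 2 / blkLap (F.dd m)) * energy F A) ^ 2 :=
        pow_le_pow_left₀ (mul_nonneg (norm_nonneg _) (norm_nonneg _)) h 2
    _ = (∑ m, ‖F.wQ m κ‖ ^ 2 / blkLap (F.dd m)) * energy F A := Real.sq_sqrt h0

/-- [folklore] **(o2) THE BAD ALIAS IS CONTROLLED BY THE Q ROWS** (block Poincaré with zero average, gauge feedback explicit): on `ker B`,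
for every alias `m₀` and polarisation `κ`,
`‖wQ_{m₀κ}‖·‖A_{m₀κ}‖ ≤ √((Σ_{m≠m₀} ‖wQ_{mκ}‖²/ℓ_m)·E(A)) + ‖c‖·‖Σ_{m≠m₀} wQ_{mκ}∂_{mκ}wG_m/L_m²‖`. -/
theorem norm_wQ_mul_norm_apply_le [Fintype ι] [DecidableEq ι] (F : Fibre D ι) (hre : ∀ m κ, F.db m κ = conj (F.dd m κ))
    {A : ι → Fin D → ℂ} {c : ℂ} (hG : GRows F 0 A c) (hQ : QRows F 0 A) (m₀ : ι) (κ : Fin D) :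
    ‖F.wQ m₀ κ‖ * ‖A m₀ κ‖
      ≤ Real.sqrt ((∑ m ∈ Finset.univ.erase m₀, ‖F.wQ m κ‖ ^ 2 / blkLap (F.dd m)) * energy F A)
        + ‖c‖ * ‖∑ m ∈ Finset.univ.erase m₀, F.wQ m κ * F.dd m κ * F.wG m / F.L m ^ 2‖ := by
  rw [← norm_mul, wQ_mul_apply_eq F hre hG hQ m₀ κ]
  calc ‖-(∑ m ∈ Finset.univ.erase m₀, F.wQ m κ * trans F A m κ)
          - c * ∑ m ∈ Finset.univ.erase m₀, F.wQ m κ * F.dd m κ * F.wG m / F.L m ^ 2‖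
      ≤ ‖-(∑ m ∈ Finset.univ.erase m₀, F.wQ m κ * trans F A m κ)‖
          + ‖c * ∑ m ∈ Finset.univ.erase m₀, F.wQ m κ * F.dd m κ * F.wG m / F.L m ^ 2‖ := norm_sub_le _ _
    _ ≤ _ := by
        rw [norm_neg, norm_mul]
        exact add_le_add (norm_sum_wQ_trans_le F hre A _ κ) le_rfl

/-- [folklore] **(o3) THE GOOD ALIASES' TRANSVERSE PARTS**: if `0 < λ ≤ ℓ_m` for every `m ≠ m₀` then
`Σ_{m≠m₀} Σ_κ ‖t_{mκ}‖² ≤ E(A)/λ` (no kernel hypothesis needed). -/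
theorem sum_normSq_trans_le [Fintype ι] [DecidableEq ι] (F : Fibre D ι) (A : ι → Fin D → ℂ) (m₀ : ι) {lam : ℝ} (hlam : 0 < lam)
    (hle : ∀ m, m ≠ m₀ → lam ≤ blkLap (F.dd m)) :
    ∑ m ∈ Finset.univ.erase m₀, ∑ κ, ‖trans F A m κ‖ ^ 2 ≤ energy F A / lam := by
  rw [le_div_iff₀ hlam, Finset.sum_mul]
  calc ∑ m ∈ Finset.univ.erase m₀, (∑ κ, ‖trans F A m κ‖ ^ 2) * lam
      ≤ ∑ m ∈ Finset.univ.erase m₀, blkLap (F.dd m) * ∑ κ, ‖trans F A m κ‖ ^ 2 :=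
        Finset.sum_le_sum fun m hm => by
          rw [mul_comm]
          exact mul_le_mul_of_nonneg_right (hle m (Finset.ne_of_mem_erase hm)) (Finset.sum_nonneg fun _ _ => sq_nonneg _)
    _ ≤ energy F A := Finset.sum_le_univ_sum_of_nonneg fun m =>
        mul_nonneg (blkLap_nonneg _) (Finset.sum_nonneg fun _ _ => sq_nonneg _)

/-- [folklore] **(o4) THE GOOD ALIASES' FULL MASS ON `ker B`**: `Σ_{m≠m₀} Σ_κ ‖A_{mκ}‖² = Σ_{m≠m₀} Σ_κ‖t_{mκ}‖² + ‖c‖²·Σ_{m≠m₀} ‖wG_m‖²/ℓ_m³`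
(Pythagoras per block; the longitudinal parts are ALL driven by the one gauge constant). -/
theorem sum_normSq_eq_of_GRows' [Fintype ι] [DecidableEq ι] (F : Fibre D ι) (hre : ∀ m κ, F.db m κ = conj (F.dd m κ))
    {A : ι → Fin D → ℂ} {c : ℂ} (hG : GRows F 0 A c) (s : Finset ι) :
    ∑ m ∈ s, ∑ κ, ‖A m κ‖ ^ 2 = ∑ m ∈ s, ∑ κ, ‖trans F A m κ‖ ^ 2 + ‖c‖ ^ 2 * ∑ m ∈ s, ‖F.wG m‖ ^ 2 / blkLap (F.dd m) ^ 3 := by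
  rw [Finset.mul_sum, ← Finset.sum_add_distrib]
  refine Finset.sum_congr rfl fun m _ => ?_
  rw [sum_normSq_eq_of_GRows F hre hG m]
  ring

/-! ## §6 The assembled kernel-control bound (constants displayed; any Euclidean weighting follows) -/

/-- [folklore] **KERNEL CONTROL OF THE REAL KKT FIBRE, FINE UNITS.**  On `ker B` (`GRows F 0 A c ∧ QRows F 0 A`), with a distinguished alias `m₀`
and real constants
* `0 < lam ≤ ℓ_m` for `m ≠ m₀` (fibre: `lam = 4/N²`),
* `0 < β ≤ ‖wQ_{m₀κ}‖` for all `κ` (fibre: `β = (2/π)^{D+1}N^{D+1}`),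
* `Σ_{m≠m₀} ‖wQ_{mκ}‖²/ℓ_m ≤ aO`, `‖Σ_{m≠m₀} wQ_{mκ}∂_{mκ}wG_m/L_m²‖ ≤ bO` for all `κ`, `Σ_{m≠m₀}‖wG_m‖²/ℓ_m³ ≤ gO`,
* the gauge constant already bounded by the energy, `‖c‖ ≤ Cc·√E(A)` (from `norm_c_le`),
the total fine mass is controlled by the transverse energy:
`Σ_m Σ_κ ‖A_{mκ}‖² ≤ (D·((√aO + Cc·bO)/β)² + 1/lam + Cc²·gO) · E(A)`. -/
theorem sum_normSq_le_energy [Fintype ι] [DecidableEq ι] (F : Fibre D ι) (hre : ∀ m κ, F.db m κ = conj (F.dd m κ))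
    {A : ι → Fin D → ℂ} {c : ℂ} (hG : GRows F 0 A c) (hQ : QRows F 0 A) (m₀ : ι)
    {lam β aO bO gO Cc : ℝ} (hlam : 0 < lam) (hle : ∀ m, m ≠ m₀ → lam ≤ blkLap (F.dd m))
    (hβ : 0 < β) (hβle : ∀ κ, β ≤ ‖F.wQ m₀ κ‖)
    (haO : ∀ κ, ∑ m ∈ Finset.univ.erase m₀, ‖F.wQ m κ‖ ^ 2 / blkLap (F.dd m) ≤ aO)
    (hbO : ∀ κ, ‖∑ m ∈ Finset.univ.erase m₀, F.wQ m κ * F.dd m κ * F.wG m / F.L m ^ 2‖ ≤ bO)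
    (hgO : ∑ m ∈ Finset.univ.erase m₀, ‖F.wG m‖ ^ 2 / blkLap (F.dd m) ^ 3 ≤ gO)
    (hCc : 0 ≤ Cc) (hc : ‖c‖ ≤ Cc * Real.sqrt (energy F A)) :
    ∑ m, ∑ κ, ‖A m κ‖ ^ 2 ≤ (D * ((Real.sqrt aO + Cc * bO) / β) ^ 2 + 1 / lam + Cc ^ 2 * gO) * energy F A := by
  set E := energy F A with hE
  have hE0 : 0 ≤ E := energy_nonneg F A
  have hsE := Real.sqrt_nonneg E
  have hsq : Real.sqrt E ^ 2 = E := Real.sq_sqrt hE0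
  -- the bad alias, polarisation by polarisation
  have hbad : ∀ κ, ‖A m₀ κ‖ ^ 2 ≤ ((Real.sqrt aO + Cc * bO) / β) ^ 2 * E := by
    intro κ
    have h1 := norm_wQ_mul_norm_apply_le F hre hG hQ m₀ κ
    have h2 : Real.sqrt ((∑ m ∈ Finset.univ.erase m₀, ‖F.wQ m κ‖ ^ 2 / blkLap (F.dd m)) * E) ≤ Real.sqrt aO * Real.sqrt E := by
      rw [← Real.sqrt_mul' aO hE0]
      exact Real.sqrt_le_sqrt (mul_le_mul_of_nonneg_right (haO κ) hE0)
    have h3 : ‖c‖ * ‖∑ m ∈ Finset.univ.erase m₀, F.wQ m κ * F.dd m κ * F.wG m / F.L m ^ 2‖ ≤ Cc * Real.sqrt E * bO :=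
      mul_le_mul hc (hbO κ) (norm_nonneg _) (mul_nonneg hCc hsE)
    have h4 : β * ‖A m₀ κ‖ ≤ (Real.sqrt aO + Cc * bO) * Real.sqrt E := by
      calc β * ‖A m₀ κ‖ ≤ ‖F.wQ m₀ κ‖ * ‖A m₀ κ‖ := mul_le_mul_of_nonneg_right (hβle κ) (norm_nonneg _)
        _ ≤ Real.sqrt aO * Real.sqrt E + Cc * Real.sqrt E * bO := le_trans h1 (add_le_add h2 h3)
        _ = (Real.sqrt aO + Cc * bO) * Real.sqrt E := by ring
    have h5 : ‖A m₀ κ‖ ≤ (Real.sqrt aO + Cc * bO) / β * Real.sqrt E := by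
      rw [div_mul_eq_mul_div, le_div_iff₀ hβ, mul_comm]
      exact h4
    calc ‖A m₀ κ‖ ^ 2 ≤ ((Real.sqrt aO + Cc * bO) / β * Real.sqrt E) ^ 2 := pow_le_pow_left₀ (norm_nonneg _) h5 2
      _ = ((Real.sqrt aO + Cc * bO) / β) ^ 2 * E := by rw [mul_pow, hsq]
  have hbad' : ∑ κ, ‖A m₀ κ‖ ^ 2 ≤ D * (((Real.sqrt aO + Cc * bO) / β) ^ 2 * E) := by
    calc ∑ κ, ‖A m₀ κ‖ ^ 2 ≤ ∑ _κ : Fin D, ((Real.sqrt aO + Cc * bO) / β) ^ 2 * E := Finset.sum_le_sum fun κ _ => hbad κ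
      _ = D * (((Real.sqrt aO + Cc * bO) / β) ^ 2 * E) := by
          rw [Finset.sum_const, Finset.card_univ, Fintype.card_fin, nsmul_eq_mul]
  -- the good aliases
  have hc2 : ‖c‖ ^ 2 ≤ Cc ^ 2 * E := by
    calc ‖c‖ ^ 2 ≤ (Cc * Real.sqrt E) ^ 2 := pow_le_pow_left₀ (norm_nonneg _) hc 2
      _ = Cc ^ 2 * E := by rw [mul_pow, hsq]
  have hgood : ∑ m ∈ Finset.univ.erase m₀, ∑ κ, ‖A m κ‖ ^ 2 ≤ E / lam + Cc ^ 2 * E * gO := by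
    rw [sum_normSq_eq_of_GRows' F hre hG (Finset.univ.erase m₀)]
    refine add_le_add (sum_normSq_trans_le F A m₀ hlam hle) ?_
    exact mul_le_mul hc2 hgO (Finset.sum_nonneg fun m _ => div_nonneg (sq_nonneg _) (pow_nonneg (blkLap_nonneg _) 3))
      (by positivity)
  -- assemble
  rw [← Finset.add_sum_erase _ _ (Finset.mem_univ m₀)]
  calc ∑ κ, ‖A m₀ κ‖ ^ 2 + ∑ m ∈ Finset.univ.erase m₀, ∑ κ, ‖A m κ‖ ^ 2
      ≤ D * (((Real.sqrt aO + Cc * bO) / β) ^ 2 * E) + (E / lam + Cc ^ 2 * E * gO) := add_le_add hbad' hgood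
    _ = (D * ((Real.sqrt aO + Cc * bO) / β) ^ 2 + 1 / lam + Cc ^ 2 * gO) * E := by ring

/-- [folklore] **KERNEL CONTROL, SQUARED CURRENCY** (no square roots; the form the fibre instantiation uses): on `ker B`, with
`0 < lam ≤ ℓ_m (m ≠ m₀)`, `0 < β2 ≤ ‖wQ_{m₀κ}‖²`, `Σ_{m≠m₀}‖wQ_{mκ}‖²/ℓ_m ≤ aO`, `‖Σ_{m≠m₀} wQ_{mκ}∂_{mκ}wG_m/L_m²‖² ≤ bO2`,
`Σ_{m≠m₀}‖wG_m‖²/ℓ_m³ ≤ gO` and `‖c‖² ≤ Cc2·E(A)`: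
`Σ_m Σ_κ ‖A_{mκ}‖² ≤ (D·(2(aO + Cc2·bO2)/β2) + 1/lam + Cc2·gO)·E(A)`. -/
theorem sum_normSq_le_energy_sq [Fintype ι] [DecidableEq ι] (F : Fibre D ι) (hre : ∀ m κ, F.db m κ = conj (F.dd m κ))
    {A : ι → Fin D → ℂ} {c : ℂ} (hG : GRows F 0 A c) (hQ : QRows F 0 A) (m₀ : ι)
    {lam β2 aO bO2 gO Cc2 : ℝ} (hlam : 0 < lam) (hle : ∀ m, m ≠ m₀ → lam ≤ blkLap (F.dd m))
    (hβ : 0 < β2) (hβle : ∀ κ, β2 ≤ ‖F.wQ m₀ κ‖ ^ 2)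
    (haO : ∀ κ, ∑ m ∈ Finset.univ.erase m₀, ‖F.wQ m κ‖ ^ 2 / blkLap (F.dd m) ≤ aO)
    (hbO : ∀ κ, ‖∑ m ∈ Finset.univ.erase m₀, F.wQ m κ * F.dd m κ * F.wG m / F.L m ^ 2‖ ^ 2 ≤ bO2)
    (hgO : ∑ m ∈ Finset.univ.erase m₀, ‖F.wG m‖ ^ 2 / blkLap (F.dd m) ^ 3 ≤ gO)
    (hCc : 0 ≤ Cc2) (hc : ‖c‖ ^ 2 ≤ Cc2 * energy F A) :
    ∑ m, ∑ κ, ‖A m κ‖ ^ 2 ≤ (D * (2 * (aO + Cc2 * bO2) / β2) + 1 / lam + Cc2 * gO) * energy F A := by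
  set E := energy F A with hE
  have hE0 : 0 ≤ E := energy_nonneg F A
  -- the bad alias, polarisation by polarisation, in squares
  have hbad : ∀ κ, ‖A m₀ κ‖ ^ 2 ≤ 2 * (aO + Cc2 * bO2) / β2 * E := by
    intro κ
    set X := Real.sqrt ((∑ m ∈ Finset.univ.erase m₀, ‖F.wQ m κ‖ ^ 2 / blkLap (F.dd m)) * E) with hX
    set Y := ‖c‖ * ‖∑ m ∈ Finset.univ.erase m₀, F.wQ m κ * F.dd m κ * F.wG m / F.L m ^ 2‖ with hY
    have h1 : ‖F.wQ m₀ κ‖ * ‖A m₀ κ‖ ≤ X + Y := norm_wQ_mul_norm_apply_le F hre hG hQ m₀ κ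
    have hX2 : X ^ 2 ≤ aO * E := by
      rw [hX, Real.sq_sqrt (mul_nonneg (Finset.sum_nonneg fun m _ => div_nonneg (sq_nonneg _) (blkLap_nonneg _)) hE0)]
      exact mul_le_mul_of_nonneg_right (haO κ) hE0
    have hY2 : Y ^ 2 ≤ Cc2 * E * bO2 := by
      rw [hY, mul_pow]
      exact mul_le_mul hc (hbO κ) (sq_nonneg _) (mul_nonneg hCc hE0)
    have h2 : (‖F.wQ m₀ κ‖ * ‖A m₀ κ‖) ^ 2 ≤ 2 * (aO + Cc2 * bO2) * E := by
      calc (‖F.wQ m₀ κ‖ * ‖A m₀ κ‖) ^ 2 ≤ (X + Y) ^ 2 :=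
            pow_le_pow_left₀ (mul_nonneg (norm_nonneg _) (norm_nonneg _)) h1 2
        _ ≤ 2 * X ^ 2 + 2 * Y ^ 2 := by nlinarith [sq_nonneg (X - Y)]
        _ ≤ 2 * (aO * E) + 2 * (Cc2 * E * bO2) := by linarith
        _ = 2 * (aO + Cc2 * bO2) * E := by ring
    have h3 : β2 * ‖A m₀ κ‖ ^ 2 ≤ 2 * (aO + Cc2 * bO2) * E := by
      calc β2 * ‖A m₀ κ‖ ^ 2 ≤ ‖F.wQ m₀ κ‖ ^ 2 * ‖A m₀ κ‖ ^ 2 := mul_le_mul_of_nonneg_right (hβle κ) (sq_nonneg _)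
        _ = (‖F.wQ m₀ κ‖ * ‖A m₀ κ‖) ^ 2 := by ring
        _ ≤ 2 * (aO + Cc2 * bO2) * E := h2
    rw [div_mul_eq_mul_div, le_div_iff₀ hβ, mul_comm]
    exact h3
  have hbad' : ∑ κ, ‖A m₀ κ‖ ^ 2 ≤ D * (2 * (aO + Cc2 * bO2) / β2 * E) := by
    calc ∑ κ, ‖A m₀ κ‖ ^ 2 ≤ ∑ _κ : Fin D, 2 * (aO + Cc2 * bO2) / β2 * E := Finset.sum_le_sum fun κ _ => hbad κ
      _ = D * (2 * (aO + Cc2 * bO2) / β2 * E) := by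
          rw [Finset.sum_const, Finset.card_univ, Fintype.card_fin, nsmul_eq_mul]
  -- the good aliases
  have hgood : ∑ m ∈ Finset.univ.erase m₀, ∑ κ, ‖A m κ‖ ^ 2 ≤ E / lam + Cc2 * E * gO := by
    rw [sum_normSq_eq_of_GRows' F hre hG (Finset.univ.erase m₀)]
    refine add_le_add (sum_normSq_trans_le F A m₀ hlam hle) ?_
    exact mul_le_mul hc hgO (Finset.sum_nonneg fun m _ => div_nonneg (sq_nonneg _) (pow_nonneg (blkLap_nonneg _) 3))
      (mul_nonneg hCc hE0)
  rw [← Finset.add_sum_erase _ _ (Finset.mem_univ m₀)]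
  calc ∑ κ, ‖A m₀ κ‖ ^ 2 + ∑ m ∈ Finset.univ.erase m₀, ∑ κ, ‖A m κ‖ ^ 2
      ≤ D * (2 * (aO + Cc2 * bO2) / β2 * E) + (E / lam + Cc2 * E * gO) := add_le_add hbad' hgood
    _ = (D * (2 * (aO + Cc2 * bO2) / β2) + 1 / lam + Cc2 * gO) * E := by ring

/-- [folklore] … and the gauge constant's own weight: `‖c‖² ≤ Cc²·E(A)` (so any Euclidean weighting `Σ_m σ_m² Σ_κ‖A_{mκ}‖² + σ_c²‖c‖²` is
`≤ (max_m σ_m² · K + σ_c² · Cc²) · E(A)` with the `K` of `sum_normSq_le_energy`). -/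
theorem norm_c_sq_le [Fintype ι] (F : Fibre D ι) {A : ι → Fin D → ℂ} {c : ℂ} {Cc : ℝ}
    (hc : ‖c‖ ≤ Cc * Real.sqrt (energy F A)) : ‖c‖ ^ 2 ≤ Cc ^ 2 * energy F A := by
  calc ‖c‖ ^ 2 ≤ (Cc * Real.sqrt (energy F A)) ^ 2 := pow_le_pow_left₀ (norm_nonneg _) hc 2
    _ = Cc ^ 2 * energy F A := by rw [mul_pow, Real.sq_sqrt (energy_nonneg F A)]

end Summit.QuantumFields.BalabanUV.Beta.GAN24.FibreKernelControlBounds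

end
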